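/-
Copyright: the b2b-balaban T⁴-continuum CRUX team, row NE7b OWNER lineage `t4-ne7b-p1` (gen 139). Project licence.
-/
import Summits.QuantumFields.BalabanUV.T4Continuum.Spine.NE7b.SupBlockCovarianceKernelLetter
import Summits.QuantumFields.BalabanUV.T4Continuum.Spine.NE7b.SupBlockFirstOrderLetters

/-!
# THE OUTPUT HESSIAN KERNEL LETTER OF THE BLOCK CLASS IN THE INPUT'S OWN LETTERS (SCOPING (d10)(2) CLOSED ⟹ (d10)(3) READY): for the
# `Y`-local block class of (399)–(427) (`U ∈ C²`, `‖U″‖ ≤ κ₂`, stability `κ₀`, gradient letter `κ₁, a`, Hessian row-sum letter `κr`, the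
# regulator `(2κ₀(1+τ)+4δ)γ_op ≤ θ < 1`) tilted against `N(0, M⁻¹)` with a PRECISION `M ≻ 0` that ROW- AND COLUMN-DOMINATES THE INPUT'S
# KERNEL, `Σ_{w≠x}(|M_{xw}| + κ₂[x∈Y][w∈Y]) ≤ γ(M_{xx} − κ₂)`, `γ < 1` (columns `≤ γ′ < 1`), `cmin ≤ M_{xx} − κ₂`, the Hessian of
# `W = −log Z` has the KERNEL LETTER
#   `Σ_y |HessW(ψ)[e_x,e_y]| ≤ κr + ((|Y|+1)κ₂)²·(1−γ)⁻¹(1−γ′)⁻¹∕cmin`   for every background `ψ` and site `x`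
# — (450) with its first-order and moment letters DISCHARGED from the class ((451): mean value; the regulator: second moments): the input of
# the (d10)(3) re-run of (427) in kernel letters (row NE7b, node U5c; (450), (451), (401)∕(297)'s regulator BY NAME; [folklore])

Cell `pub-balaban`, sub-cell `t4`, spine estimate NE7b (`T4WeightBudget.RelWeightBound`; the cell's OWN estimate — NOT PRINTED in
[Bałaban 1983–89], NOT PROVED).  Crux-route work under `Spine/NE7b/` by the row OWNER (`t4-ne7b-p1` gen 139, file (452)) under FREEZE
(0)'s crux-prover clause; NOTHING of Bałaban's is named as a Lean object, valued or asserted; no `T4Continuum/Support` leaf typed; no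
`def`, no notation; zero `sorry`.  Imports (BY NAME): the OWNER's (450) `…SupBlockCovarianceKernelLetter` (`block_hessian_kernel_rowsum_le`),
(451) `…SupBlockFirstOrderLetters` (`first_order_cross∕ceiling∕floor`, `block_kernel_majorant`, `block_Hd_rowsum_le∕colsum_le`),
`SupBlockEffectiveActionDerivative` (`integrable_exp_neg_block`, `neg_block_le`), `SupGaussianRegulator` (`integrable_exp_half_weighted_sq`).

WHAT IS PROVED ([folklore]):
* §1 `sq_le_exp_div` (`t ≤ e^{2δt}∕(2δ)` for `t ≥ 0`), **`block_second_moment_integrable`** (`e^{−U(ω+ψ)}ω_w² ∈ L¹(N(0,Γ))` from stability and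
  the regulator with `4δ` room — the moment letter `hI2` of (450)).
* §2 THE END **`block_class_hessian_kernel_rowsum_le`**.
* §3 toy: none (letters in, letter out).

HONEST (what this is NOT).  The precision's row∕column dominance over the input kernel is a CONDITION ON THE NEXT COVARIANCE `M⁻¹` in
kernel (ℓ^∞) letters (for a massive lattice precision `M = −Δ + m²` restricted to the fluctuation field it reads `2d + (|Y|+1)κ₂·[x∈Y] ≤
γ(2d + m² − κ₂)`: small input kernel against the mass); it is NOT verified for the road's dressed covariance here.  The (d10)(3) re-run
(output class letters in kernel form, then (436)'s `μ, C, ν`) and (d10)(4) (several blocks: majorant `κ₂·[x,z in one block]`, same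
letters) are the successor's.  Scalar skeleton ((A3), NC-NE7b-α UNRULED); nothing of Bałaban's asserted.  BY-NAME EFFECT ON THE WALL: NONE.
NE7b NOT PRINTED ∕ NOT PROVED; spine PROVED 0∕9; rung (B)+1 — the programme's measures remain FINITE-torus statements; NOT the mass gap,
NOT Clay.  HONEST DEPENDENCY: continuum YM on T⁴ ⇐ BetaPertH ∧ nine spine estimates (0∕9 proved); BetaPertH ⇐ (D1) ∧ (D4) ∧ CAP+tail;
G-an2-4 gates asym, D1 and NE2∕3∕4.
-/

set_option autoImplicit false
set_option maxSynthPendingDepth 2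

noncomputable section

namespace Summit.QuantumFields.BalabanUV.T4Continuum.NE7b.SupBlockHessianKernelLetter

open MeasureTheory ProbabilityTheory Real Set Function Finset Matrix
open scoped BigOperators
open SupBlockCovarianceKernelLetter (block_hessian_kernel_rowsum_le)
open SupBlockFirstOrderLetters (first_order_cross first_order_ceiling first_order_floor block_kernel_majorant block_Hd_rowsum_le
  block_Hd_colsum_le)
open SupBlockEffectiveActionDerivative (integrable_exp_neg_block neg_block_le)
open SupGaussianRegulator (integrable_exp_half_weighted_sq)

variable {ι : Type} [Fintype ι] [DecidableEq ι]

variable {M : Matrix ι ι ℝ} {γop : ℝ} {U : EuclideanSpace ℝ ι → ℝ} {U' : EuclideanSpace ℝ ι → EuclideanSpace ℝ ι →L[ℝ] ℝ}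
  {U'' : EuclideanSpace ℝ ι → EuclideanSpace ℝ ι →L[ℝ] EuclideanSpace ℝ ι →L[ℝ] ℝ} {κ₀ κ₁ κ₂ κr a τ δ θ : ℝ}
  {ψ : EuclideanSpace ℝ ι} {mM γ γ' cmin : ℝ}

/-! ## §1. The second-moment letter from the regulator -/

omit [Fintype ι] [DecidableEq ι] in
/-- `t ≤ e^{2δt}∕(2δ)` for `δ > 0` (from `x ≤ e^x`). [folklore] -/
theorem sq_le_exp_div {δ : ℝ} (hδ : 0 < δ) (t : ℝ) : t ≤ exp (2 * δ * t) / (2 * δ) := by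
  rw [le_div_iff₀ (by positivity)]
  have h := add_one_le_exp (2 * δ * t)
  nlinarith [exp_pos (2 * δ * t)]

/-- **THE SECOND-MOMENT LETTER**: stability `−κ₀Σ_Yφ² ≤ U(φ)`, `U` measurable and the regulator `(2κ₀(1+τ)+4δ)γ_op ≤ θ < 1` give
`e^{−U(ω+ψ)}·ω_w² ∈ L¹(N(0,Γ))` for every site `w` (the weight `4δ` at `w` absorbs `ω_w²`). [folklore] -/
theorem block_second_moment_integrable {Γ : Matrix ι ι ℝ} (hΓ : Γ.PosSemidef) (hΓop : (γop • (1 : Matrix ι ι ℝ) - Γ).PosSemidef) (Y : Finset ι)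
    (hUm : Measurable U) (hκ₀ : 0 ≤ κ₀) (hτ : 0 < τ) (hδ : 0 < δ) (hθ1 : θ < 1) (hκθ : (2 * κ₀ * (1 + τ) + 4 * δ) * γop ≤ θ)
    (hstab : ∀ φ : EuclideanSpace ℝ ι, -(κ₀ * ∑ x ∈ Y, φ x ^ 2) ≤ U φ) (ψ : EuclideanSpace ℝ ι) (w : ι) :
    Integrable (fun ω : EuclideanSpace ℝ ι => exp (-U (ω + ψ)) * ω w ^ 2) (multivariateGaussian 0 Γ) := by
  -- the weights `2κ₀(1+τ)·1_Y + 4δ·1_{w}`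
  set wt : ι → ℝ := fun i => (if i ∈ Y then 2 * κ₀ * (1 + τ) else 0) + (if i = w then 4 * δ else 0) with hwt
  have hk0 : 0 ≤ 2 * κ₀ * (1 + τ) := by positivity
  have hwt0 : ∀ i, 0 ≤ wt i := fun i => by
    simp only [hwt]; split_ifs <;> linarith
  have hwtκ : ∀ i, wt i ≤ 2 * κ₀ * (1 + τ) + 4 * δ := fun i => by
    simp only [hwt]; split_ifs <;> linarith
  have hint := (integrable_exp_half_weighted_sq hΓ hΓop wt hwt0 hwtκ (by positivity) hθ1 hκθ).const_mul
    (exp (κ₀ * (1 + τ⁻¹) * ∑ x ∈ Y, ψ x ^ 2) / (2 * δ))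
  have hmeas : Measurable fun ω : EuclideanSpace ℝ ι => exp (-U (ω + ψ)) * ω w ^ 2 :=
    (measurable_exp.comp (hUm.comp (measurable_id.add_const ψ)).neg).mul
      ((by fun_prop : Continuous fun ω : EuclideanSpace ℝ ι => ω w).measurable.pow_const 2)
  refine hint.mono' hmeas.aestronglyMeasurable (ae_of_all _ fun ω => ?_)
  rw [Real.norm_of_nonneg (mul_nonneg (exp_pos _).le (sq_nonneg _))]
  -- `e^{−U(ω+ψ)} ≤ e^{κ₀(1+τ⁻¹)Σψ²}·e^{κ₀(1+τ)Σ_Yω²}` and `ω_w² ≤ e^{2δω_w²}/(2δ)`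
  have h1 := neg_block_le Y hκ₀ hτ hstab ω ψ
  have h2 := sq_le_exp_div hδ (ω w ^ 2)
  have hsum : κ₀ * (1 + τ) * ∑ x ∈ Y, ω x ^ 2 + 2 * δ * ω w ^ 2 = (∑ i, wt i * ω i ^ 2) / 2 := by
    simp only [hwt, add_mul, Finset.sum_add_distrib, ite_mul, zero_mul]
    rw [Finset.sum_ite_eq' Finset.univ w, if_pos (Finset.mem_univ w), Finset.sum_ite_mem, Finset.univ_inter, ← Finset.mul_sum]
    ring
  calc exp (-U (ω + ψ)) * ω w ^ 2 ≤ exp (κ₀ * (1 + τ) * ∑ x ∈ Y, ω x ^ 2 + κ₀ * (1 + τ⁻¹) * ∑ x ∈ Y, ψ x ^ 2) * (exp (2 * δ * ω w ^ 2) / (2 * δ)) :=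
        mul_le_mul (exp_le_exp.2 h1) h2 (sq_nonneg _) (exp_pos _).le
    _ = exp (κ₀ * (1 + τ⁻¹) * ∑ x ∈ Y, ψ x ^ 2) / (2 * δ) * exp ((∑ i, wt i * ω i ^ 2) / 2) := by
        rw [← hsum, exp_add, exp_add]; field_simp
    _ = exp (κ₀ * (1 + τ⁻¹) * ∑ x ∈ Y, ψ x ^ 2) / (2 * δ) * exp ((∑ i, wt i * ω i ^ 2) / 2) := rfl

/-! ## §2. The output Hessian's kernel letter in the input's letters -/

/-- **THE OUTPUT HESSIAN KERNEL LETTER OF THE BLOCK CLASS** in the input's own letters: the `Y`-local block class of (399)–(427) under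
`N(0,M⁻¹)` with a precision `M ≻ 0` whose rows and columns dominate the input kernel (`Σ_{w≠x}(|M_{xw}| + κ₂[x∈Y][w∈Y]) ≤ γ(M_{xx} − κ₂)`,
`γ < 1`; columns `≤ γ′ < 1`; `cmin ≤ M_{xx} − κ₂`, `|M_{xx}| ≤ mM`) has
`Σ_y |HessW(ψ)[e_x,e_y]| ≤ κr + ((|Y|+1)κ₂)·((|Y|+1)κ₂)·(1−γ)⁻¹(1−γ′)⁻¹∕cmin` for every `ψ, x`. [folklore] -/
theorem block_class_hessian_kernel_rowsum_le (hM : M.PosDef) (hΓop : (γop • (1 : Matrix ι ι ℝ) - M⁻¹).PosSemidef) (Y : Finset ι)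
    (hUd : ∀ φ : EuclideanSpace ℝ ι, HasFDerivAt U (U' φ) φ) (hU'd : ∀ φ : EuclideanSpace ℝ ι, HasFDerivAt U' (U'' φ) φ)
    (hU''c : Continuous U'') (hκ₀ : 0 ≤ κ₀) (hκ₁ : 0 ≤ κ₁) (ha : 0 ≤ a) (hκ₂ : 0 ≤ κ₂) (hτ : 0 < τ) (hδ : 0 < δ) (hθ0 : 0 < θ) (hθ1 : θ < 1)
    (hκθ : (2 * κ₀ * (1 + τ) + 4 * δ) * γop ≤ θ) (hstab : ∀ φ : EuclideanSpace ℝ ι, -(κ₀ * ∑ x ∈ Y, φ x ^ 2) ≤ U φ)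
    (hU'b : ∀ φ : EuclideanSpace ℝ ι, ‖U' φ‖ ≤ κ₁ * (a + ∑ x ∈ Y, φ x ^ 2)) (hU''b : ∀ φ : EuclideanSpace ℝ ι, ‖U'' φ‖ ≤ κ₂)
    (hU''row : ∀ (φ : EuclideanSpace ℝ ι) (x : ι), ∑ y, |U'' φ (EuclideanSpace.single x (1 : ℝ)) (EuclideanSpace.single y (1 : ℝ))| ≤ κr)
    (hUloc : ∀ φ φ' : EuclideanSpace ℝ ι, (∀ x ∈ Y, φ x = φ' x) → U φ = U φ')
    (hMdiag : ∀ x, |M x x| ≤ mM) (hcmin : 0 < cmin) (hcm : ∀ x, cmin ≤ M x x - κ₂)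
    (hrow : ∀ x, ∑ w, (if w = x then 0 else |M x w| + (if x ∈ Y ∧ w ∈ Y then κ₂ else 0)) / (M x x - κ₂) ≤ γ) (hγ0 : 0 ≤ γ) (hγ1 : γ < 1)
    (hcol : ∀ w, ∑ x, (if w = x then 0 else |M x w| + (if x ∈ Y ∧ w ∈ Y then κ₂ else 0)) / (M x x - κ₂) ≤ γ') (hγ'1 : γ' < 1) (x : ι) :
    ∑ y, |((∫ ω : EuclideanSpace ℝ ι, exp (-U (ω + ψ)) ∂(multivariateGaussian 0 M⁻¹))⁻¹ • (∫ ω : EuclideanSpace ℝ ι, exp (-U (ω + ψ)) • (U'' (ω + ψ) - (U' (ω +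
        ψ)).smulRight (U' (ω + ψ))) ∂(multivariateGaussian 0 M⁻¹)) + (((∫ ω : EuclideanSpace ℝ ι, exp (-U (ω + ψ)) ∂(multivariateGaussian 0 M⁻¹)) ^ 2)⁻¹ • ∫ ω :
        EuclideanSpace ℝ ι, exp (-U (ω + ψ)) • U' (ω + ψ) ∂(multivariateGaussian 0 M⁻¹)).smulRight (∫ ω : EuclideanSpace ℝ ι, exp (-U (ω + ψ)) • U' (ω + ψ)
        ∂(multivariateGaussian 0 M⁻¹))) (EuclideanSpace.single x (1 : ℝ)) (EuclideanSpace.single y (1 : ℝ))| ≤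
      κr + ((Y.card + 1) * κ₂) * ((Y.card + 1) * κ₂) * (1 - γ)⁻¹ * (1 - γ')⁻¹ / cmin := by
  have hΓ : (M⁻¹).PosSemidef := hM.inv.posSemidef
  have hUm : Measurable U := (continuous_iff_continuousAt.2 fun φ => (hUd φ).continuousAt).measurable
  -- the first-order letters of the class ((451))
  have hHk := block_kernel_majorant Y hUd hU'd hUloc hU''b
  have hκd : ∀ x, (if x ∈ Y ∧ x ∈ Y then κ₂ else (0 : ℝ)) ≤ κ₂ := fun x => by split_ifs <;> linarith
  have hH : ∀ x w, 0 ≤ (if x ∈ Y ∧ w ∈ Y then κ₂ else (0 : ℝ)) := fun x w => by split_ifs <;> linarith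
  -- the moment letters (regulator)
  have hθ2 : 2 * κ₀ * (1 + τ) * γop ≤ θ := by
    rcases le_or_gt 0 γop with h | h
    · have : 2 * κ₀ * (1 + τ) * γop ≤ (2 * κ₀ * (1 + τ) + 4 * δ) * γop := mul_le_mul_of_nonneg_right (by linarith) h
      linarith
    · have : 2 * κ₀ * (1 + τ) * γop ≤ 0 := mul_nonpos_of_nonneg_of_nonpos (by positivity) h.le
      linarith
  have hI0 := integrable_exp_neg_block hΓ hΓop Y hUm hκ₀ hτ hθ1 hθ2 hstab ψ
  have hI2 := fun w => block_second_moment_integrable hΓ hΓop Y hUm hκ₀ hτ hδ hθ1 hκθ hstab ψ w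
  exact block_hessian_kernel_rowsum_le (H := fun x w => if x ∈ Y ∧ w ∈ Y then κ₂ else 0) hM hΓop Y hUd hU'd hU''c hκ₀ hκ₁ ha hκ₂ hτ hδ hθ0
    hθ1 hκθ hstab hU'b hU''b hU''row (first_order_floor hU'd hHk hκd) (first_order_ceiling hU'd hHk hκd)
    (fun x w φ r => first_order_cross hU'd hHk x w φ r) hH hκ₂ hMdiag hcmin hcm hrow hγ0 hγ1 hcol hγ'1 (block_Hd_rowsum_le Y hκ₂)
    (block_Hd_colsum_le Y hκ₂) hI0 hI2 x

end Summit.QuantumFields.BalabanUV.T4Continuum.NE7b.SupBlockHessianKernelLetter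

end
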